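import Mathlib
import HarnessLib
import Summits.Ventures.LatticeQCDFlow.Exactness.FlowMCMC
import Summits.Ventures.LatticeQCDFlow.Scoring.IMHPositiveCorrelations

/-!
# The exact flow-MCMC (IMH) chain: Liu's triangular split, the one-pass Poisson transfer and the
# finite-horizon Green–Kubo sum

HONEST FRAMING: exact (Metropolis-corrected) sampling algorithms for lattice gauge theory;
figures of merit are autocorrelation/cost numbers at stated couplings and volumes; no
continuum-physics claim.

Venture `LatticeQCDFlow` (cell pub-lqcd), topic `Scoring`; FANOUT row 8 (`s0-cpn-nemc`, GEN-9),
landing the flow seat's kernel-checked offer `HOME/canary-flow/imhlaw/lean/ImhPoissonTree.lean`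
(gen-15, `IMH-LAW-flow.md` §1 (T1)–(T3); companion `ImhPoisson.lean`, whose 'heavier states are
stickier' is restated here on the tree's kernel) in the tree's namespace, on the tree's objects
`Exactness.imhKernel p q` (`= mhKernel (fun _ y => q y) p`) and `Scoring.imhMatrix / twoTime / mv`;
nothing is re-declared.  The algebra is the cell's own elementary work (finite sums); Liu's
eigen-analysis of the independence sampler [Liu, Statistics and Computing 6 (1996) 113, Thm 2.1;
Monte Carlo Strategies in Scientific Computing §13.4] is CONTEXT for the triangular structure,
not a cited fact (its printed rate statement is the Literature file
`Probability/MarkovChains/MengersenTweedie.lean`).  The `T → ∞` limit of the Green–Kubo sum is the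
companion file `Scoring/IMHGreenKubo.lean`.

## Content

* GENERIC (`rankOneSplit`): for ANY kernel `K` with `p` stationary, `Σ p = 1`, and any vector `q`,
  the split `G := K − 𝟙 qᵀ` satisfies `pᵀ G = pᵀ − qᵀ` (`pi_rankOneSplit`), a solution `h` of
  `(I − G) h = c` with `pᵀ c = 0` has `qᵀ h = 0` (`q_avg_eq_zero`), and the POISSON TRANSFER
  (`poisson_transfer`): `pᵀ c = 0 ∧ (I − G) h = c ⟹ (I − K) h = c`.
* IMH (`liuG`): for the exact flow-MCMC chain with model law `q` the split is Liu's: `G x y = 0`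
  towards every destination at least as heavy as `x` in `w = p/q` (`liuG_eq_zero_of_heavier` — `G`
  is TRIANGULAR in decreasing-weight order), towards a lighter one `K x y = p y · q x / p x`
  (`imhKernel_eq_of_lighter`), and the diagonal of `I − G` is the move-acceptance probability out
  of `x`, `1 − G x x = q x + Σ_{z ≠ x} mhRate x z = Σ_z min (q z) (p z q x / p x) ≥ q x > 0`
  (`one_sub_liuG_diag`, `one_sub_liuG_diag_eq_sum_min`, `one_sub_liuG_diag_pos`): the triangular
  system `(I − G) h = c` is solvable by ONE back-substitution over the states sorted by weight, and
  its solution solves the chain's Poisson equation (`imh_poisson_transfer`).  This is what the flow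
  seat's `imhlaw.py` does on the stored proposal pool of a chain file (states = stored proposals,
  `q` uniform), and what the gauge seat's independent `a34_imhlaw.py` re-derived (INBOX l.3115).
* HEAVIER IS STICKIER (`one_sub_liuG_diag_antitone`): the move-acceptance `1 − G x x` is antitone
  in the weight — the heaviest state has the smallest escape probability (the `1 − 1/w⋆` of the
  Literature rate statement is its complement at the mode when `Σ p = Σ q = 1`).
* GREEN–KUBO, finite horizon (`greenKubo_partial`): if `c = h − K h` then for every `T`,
  `Σ_{t<T} S_t(c, c) = S_0(c, h) − S_T(c, h)` with `S_t(f, g) = Σ_x p_x f_x (Kᵗ g)_x` the tree's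
  two-time form `Scoring.twoTime`; `imh_greenKubo_partial` is the same for `imhMatrix p q` with the
  Poisson equation in kernel form.  Letting `T → ∞` is `Scoring/IMHGreenKubo.lean`.
-/

namespace Summit.Ventures.LatticeQCDFlow.Scoring

open Finset Literature.Probability.MarkovChains Summit.Ventures.LatticeQCDFlow.Exactness

variable {X : Type*} [Fintype X] [DecidableEq X]

/-! ### Generic: rank-one split of a stationary kernel and the Poisson transfer -/

/-- The rank-one split `G = K − 𝟙 qᵀ` of a kernel `K` by a vector `q`: `G x y = K x y − q y`. -/
def rankOneSplit (K : X → X → ℝ) (q : X → ℝ) (x y : X) : ℝ := K x y - q y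

omit [DecidableEq X] in
/-- `pᵀ G = pᵀ − qᵀ` for the rank-one split of a kernel with `p` stationary and `Σ p = 1`. -/
theorem pi_rankOneSplit {K : X → X → ℝ} {p : X → ℝ} (hK : IsStationary p K) (hp1 : ∑ x, p x = 1)
    (q : X → ℝ) (y : X) : ∑ x, p x * rankOneSplit K q x y = p y - q y := by
  unfold rankOneSplit
  simp only [mul_sub, Finset.sum_sub_distrib]
  rw [hK y, ← Finset.sum_mul, hp1, one_mul]

omit [DecidableEq X] in
/-- The `q`-average of a solution of `(I − G) h = c` with `pᵀ c = 0` vanishes: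
`qᵀ h = pᵀ (I − G) h = pᵀ c = 0`. -/
theorem q_avg_eq_zero {K : X → X → ℝ} {p : X → ℝ} (hK : IsStationary p K) (hp1 : ∑ x, p x = 1)
    (q c h : X → ℝ) (hc : ∑ x, p x * c x = 0)
    (hh : ∀ x, h x - ∑ y, rankOneSplit K q x y * h y = c x) : ∑ y, q y * h y = 0 := by
  have step : ∀ y, q y * h y = p y * h y - ∑ x, p x * rankOneSplit K q x y * h y := by
    intro y
    rw [← Finset.sum_mul, pi_rankOneSplit hK hp1 q y]
    ring
  calc ∑ y, q y * h y = ∑ y, (p y * h y - ∑ x, p x * rankOneSplit K q x y * h y) :=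
        Finset.sum_congr rfl fun y _ => step y
    _ = ∑ y, p y * h y - ∑ y, ∑ x, p x * rankOneSplit K q x y * h y := Finset.sum_sub_distrib _ _
    _ = ∑ y, p y * h y - ∑ x, ∑ y, p x * rankOneSplit K q x y * h y := by rw [Finset.sum_comm]
    _ = ∑ x, p x * (h x - ∑ y, rankOneSplit K q x y * h y) := by
        rw [← Finset.sum_sub_distrib]
        refine Finset.sum_congr rfl fun x _ => ?_
        rw [mul_sub, Finset.mul_sum]
        refine congrArg₂ _ rfl (Finset.sum_congr rfl fun y _ => ?_)
        ring
    _ = ∑ x, p x * c x := Finset.sum_congr rfl fun x _ => by rw [hh x]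
    _ = 0 := hc

omit [DecidableEq X] in
/-- **Poisson transfer**: `pᵀ c = 0 ∧ (I − G) h = c ⟹ (I − K) h = c` — a solution of the split
system solves the Poisson equation of the chain itself. -/
theorem poisson_transfer {K : X → X → ℝ} {p : X → ℝ} (hK : IsStationary p K) (hp1 : ∑ x, p x = 1)
    (q c h : X → ℝ) (hc : ∑ x, p x * c x = 0)
    (hh : ∀ x, h x - ∑ y, rankOneSplit K q x y * h y = c x) (x : X) :
    h x - ∑ y, K x y * h y = c x := by
  have split : ∑ y, K x y * h y = ∑ y, rankOneSplit K q x y * h y + ∑ y, q y * h y := by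
    rw [← Finset.sum_add_distrib]
    exact Finset.sum_congr rfl fun y _ => by unfold rankOneSplit; ring
  rw [split, q_avg_eq_zero hK hp1 q c h hc hh, add_zero]
  exact hh x

/-! ### The flow-MCMC chain: Liu's split is triangular in the importance weight -/

/-- Liu's `G = K − 𝟙 qᵀ` for the exact flow-MCMC chain `imhKernel p q` with model law `q`. -/
noncomputable def liuG (p q : X → ℝ) : X → X → ℝ := rankOneSplit (imhKernel p q) q

/-- Towards a destination at least as heavy as the current state (`w x ≤ w y`, `w = p/q`, written
cross-multiplied) the proposal is always accepted: `K x y = q y`. -/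
theorem imhKernel_eq_of_heavier {p q : X → ℝ} (hp : ∀ x, 0 < p x) {x y : X} (hxy : y ≠ x)
    (hw : p x * q y ≤ p y * q x) : imhKernel p q x y = q y := by
  unfold imhKernel
  rw [mhKernel_of_ne hxy]
  unfold mhRate
  apply min_eq_left
  rw [le_div_iff₀ (hp x)]
  linarith [mul_comm (q y) (p x)]

/-- Towards a lighter destination (`w y ≤ w x`) the move happens with probability
`p y q x / p x = q y · w y / w x`. -/
theorem imhKernel_eq_of_lighter {p q : X → ℝ} (hp : ∀ x, 0 < p x) {x y : X} (hxy : y ≠ x)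
    (hw : p y * q x ≤ p x * q y) : imhKernel p q x y = p y * q x / p x := by
  unfold imhKernel
  rw [mhKernel_of_ne hxy]
  unfold mhRate
  apply min_eq_right
  rw [div_le_iff₀ (hp x)]
  linarith [mul_comm (q y) (p x)]

/-- **Triangularity**: `G x y = 0` towards every destination at least as heavy as `x`. -/
theorem liuG_eq_zero_of_heavier {p q : X → ℝ} (hp : ∀ x, 0 < p x) {x y : X} (hxy : y ≠ x)
    (hw : p x * q y ≤ p y * q x) : liuG p q x y = 0 := by
  unfold liuG rankOneSplit
  rw [imhKernel_eq_of_heavier hp hxy hw]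
  ring

/-- Off-diagonal `G` entries are nonpositive (`K x y ≤ q y`). -/
theorem liuG_nonpos_of_ne (p q : X → ℝ) {x y : X} (hxy : x ≠ y) : liuG p q x y ≤ 0 := by
  unfold liuG rankOneSplit
  linarith [imhKernel_le p q hxy]

/-- The diagonal of `I − G` is the move-acceptance probability out of `x`:
`1 − G x x = q x + Σ_{z ≠ x} mhRate x z`. -/
theorem one_sub_liuG_diag (p q : X → ℝ) (x : X) :
    1 - liuG p q x x = q x + ∑ z ∈ univ.erase x, mhRate (fun _ y => q y) p x z := by
  unfold liuG rankOneSplit imhKernel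
  rw [mhKernel_self]
  ring

/-- … equivalently the full sum `1 − G x x = Σ_z min (q z) (p z q x / p x)`
(`= Σ_z q z · min 1 (w z / w x)`; the `z = x` term is `q x`). -/
theorem one_sub_liuG_diag_eq_sum_min {p q : X → ℝ} (hp : ∀ x, 0 < p x) (x : X) :
    1 - liuG p q x x = ∑ z, min (q z) (p z * q x / p x) := by
  rw [one_sub_liuG_diag, ← add_sum_erase _ _ (mem_univ x)]
  congr 1
  rw [mul_div_cancel_left₀ _ (hp x).ne', min_self]

/-- … and it is at least `q x > 0`: the triangular system `(I − G) h = c` has a nonsingular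
diagonal, so it is solved by one back-substitution over the states sorted by weight. -/
theorem one_sub_liuG_diag_pos {p q : X → ℝ} (hp : ∀ x, 0 < p x) (hq : ∀ x, 0 < q x) (x : X) :
    0 < 1 - liuG p q x x := by
  rw [one_sub_liuG_diag]
  exact add_pos_of_pos_of_nonneg (hq x)
    (Finset.sum_nonneg fun z _ => mhRate_nonneg (fun _ y => (hq y).le) hp x z)

/-- **Heavier states are stickier**: the move-acceptance probability `1 − G x x` out of a state is
antitone in its weight `w = p/q` (cross-multiplied: `w x ≤ w y ⟹ 1 − G y y ≤ 1 − G x x`), so the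
heaviest state has the smallest escape probability. -/
theorem one_sub_liuG_diag_antitone {p q : X → ℝ} (hp : ∀ x, 0 < p x) {x y : X}
    (hw : p x * q y ≤ p y * q x) : 1 - liuG p q y y ≤ 1 - liuG p q x x := by
  rw [one_sub_liuG_diag_eq_sum_min hp, one_sub_liuG_diag_eq_sum_min hp]
  refine sum_le_sum fun z _ => min_le_min le_rfl ?_
  rw [div_le_div_iff₀ (hp y) (hp x)]
  have hz := (hp z).le
  nlinarith [mul_le_mul_of_nonneg_left hw hz]

/-- **IMH Poisson transfer**: a solution of Liu's triangular system with `pᵀ c = 0` solves the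
Poisson equation of the exact flow-MCMC chain (`Σ p = 1`; `q` arbitrary — stationarity holds for
every model law). -/
theorem imh_poisson_transfer {p : X → ℝ} (hp : ∀ x, 0 < p x) (hp1 : ∑ x, p x = 1) (q c h : X → ℝ)
    (hc : ∑ x, p x * c x = 0) (hh : ∀ x, h x - ∑ y, liuG p q x y * h y = c x) (x : X) :
    h x - ∑ y, imhKernel p q x y * h y = c x :=
  poisson_transfer (imhKernel_isStationary hp q) hp1 q c h hc hh x

/-! ### Finite-horizon Green–Kubo: autocovariance sums from the Poisson solution -/

omit [DecidableEq X] in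
/-- `mv` is additive in the vector: `M (f − g) = M f − M g`. -/
theorem mv_sub (M : Matrix X X ℝ) (f g : X → ℝ) : mv M (f - g) = mv M f - mv M g := by
  funext x
  simp only [mv, Pi.sub_apply, mul_sub, Finset.sum_sub_distrib]

/-- `S_t(f, ·)` is additive: `S_t(f, g − g') = S_t(f, g) − S_t(f, g')`. -/
theorem twoTime_sub_right (p : X → ℝ) (M : Matrix X X ℝ) (t : ℕ) (f g g' : X → ℝ) :
    twoTime p M t f (g - g') = twoTime p M t f g - twoTime p M t f g' := by
  simp only [twoTime, mv_sub, Pi.sub_apply, mul_sub, Finset.sum_sub_distrib]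

/-- **Green–Kubo, finite horizon**: if `c = h − M h` then for every `T`,
`Σ_{t<T} S_t(c, c) = S_0(c, h) − S_T(c, h)` (telescoping `S_t(c, h − M h) = S_t(c, h) − S_{t+1}(c, h)`). -/
theorem greenKubo_partial (p : X → ℝ) (M : Matrix X X ℝ) (c h : X → ℝ) (hch : c = h - mv M h)
    (T : ℕ) : ∑ t ∈ range T, twoTime p M t c c = twoTime p M 0 c h - twoTime p M T c h := by
  have step : ∀ t, twoTime p M t c c = twoTime p M t c h - twoTime p M (t + 1) c h := by
    intro t
    have e : twoTime p M t c c = twoTime p M t c (h - mv M h) := by rw [← hch]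
    rw [e, twoTime_sub_right, twoTime_succ_right]
  rw [Finset.sum_congr rfl fun t _ => step t]
  exact Finset.sum_range_sub' (fun t => twoTime p M t c h) T

/-- The same for the exact flow-MCMC chain `imhMatrix p q`, with the Poisson equation in kernel
form `h x − Σ_y K x y h y = c x`. -/
theorem imh_greenKubo_partial (p q c h : X → ℝ) (hh : ∀ x, h x - ∑ y, imhKernel p q x y * h y = c x)
    (T : ℕ) :
    ∑ t ∈ range T, twoTime p (imhMatrix p q) t c c
      = twoTime p (imhMatrix p q) 0 c h - twoTime p (imhMatrix p q) T c h := by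
  refine greenKubo_partial p (imhMatrix p q) c h ?_ T
  funext x
  simp only [Pi.sub_apply, mv, imhMatrix_apply]
  exact (hh x).symm

end Summit.Ventures.LatticeQCDFlow.Scoring
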